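import Literature.Analysis.FluidPDE.TaoY6ChainStep
import HarnessLib

/-!
# The Whitney-scale mass bound: `∫_{B(y, d/4)} |f|² ≲ d (k W + Y/k)` along a chain of balls

Analysis/FluidPDE support file for the discharge of the named fact
`Literature.Analysis.FluidPDE.tao2011_nonlinearEstimate` (Tao 2011, §10, proof of Thm. 10.1,
estimate of `Y₆`, arXiv:1108.1165 pp. 32–33). In the printed proof the local `L²` masses
`wᵢ = (|3Bᵢ|⁻¹∫_{3Bᵢ}|ω|²)^{1/2}` of the vorticity on small Whitney balls are controlled by chaining
to a large ball ("we may iterate this until we reach a large ball `B_{a(i)}`, and write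
`wᵢ ≤ w_{a(i)} + Σₖ |w_{pᵏ(i)} − w_{pᵏ⁺¹(i)}|`", p. 33) using the Poincaré inequality for each
step and the trivial bound `wᵢ ≲ c^{0.05}δ⁻¹W^{1/2}rᵢ⁻²` ((10.23)) for large balls. This file proves
the resulting bound in the form consumed by our variant of the argument: an **abstract chain
lemma** for a `C¹` map `f` and a weight `η ≥ 0` of "slope `k`" along a ray.

* `setIntegral_ball_sq_norm_le_of_chain`: if `0 < d ≤ k⁻¹`, `|v| = 1`, and
  `η ≥ (3/4) k τ` on `B(y + (τ − d)v, τ/4)` for every `τ ∈ [d, k⁻¹]` (in the annulus: `y` at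
  depth `d`, `v` the inward unit normal, Lipschitz cutoff of slope `k`), then
  `∫_{B(y,d/4)} ‖f‖² ≤ C_M (d/4) (k ∫‖f‖²η + k⁻¹ ∫‖Df‖²η)` with `C_M = 2·10⁶`.

The chain is `tⱼ = d(3/2)ʲ`, `Bⱼ = B(y + (tⱼ − d)v, tⱼ/4)`, `j = 0, …, J` with `tⱼ` first
exceeding `k⁻¹/2` at `j = J`; consecutive balls are a ball and its parent in the sense of
`FluidPDE/TaoY6ChainStep`, the gradient on `Bⱼ ∪ Bⱼ₊₁` costs `(k tⱼ)⁻¹ ∫‖Df‖²η`, the steps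
decay geometrically (`Σ tⱼ⁻¹ ≤ 3/d`), and the mean on the terminal ball costs `k³ ∫‖f‖²η`.

## References

* T. Tao, arXiv:1108.1165 (`Tao2011`), §10, proof of Thm. 10.1, pp. 32–33 ((10.22)–(10.24) and
  the parent-ball chaining).
-/

noncomputable section

open MeasureTheory Set Filter Metric Function
open scoped ENNReal NNReal

namespace Literature.Analysis.FluidPDE.TaoY6

variable {F : Type*} [NormedAddCommGroup F] [NormedSpace ℝ F] [CompleteSpace F]

/-! ### Two elementary sums -/

/-- `Σ_{j<J} (2/3)ʲ ≤ 3`. [folklore] -/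
theorem sum_range_two_thirds_pow_le (J : ℕ) : ∑ j ∈ Finset.range J, ((2 : ℝ) / 3) ^ j ≤ 3 := by
  have h1 : Summable fun j : ℕ => ((2 : ℝ) / 3) ^ j :=
    summable_geometric_of_lt_one (by norm_num) (by norm_num)
  calc ∑ j ∈ Finset.range J, ((2 : ℝ) / 3) ^ j ≤ ∑' j : ℕ, ((2 : ℝ) / 3) ^ j :=
        h1.sum_le_tsum _ (fun j _ => by positivity)
    _ = 3 := by rw [tsum_geometric_of_lt_one (by norm_num) (by norm_num)]; norm_num

omit [NormedSpace ℝ F] [CompleteSpace F] in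
/-- Telescoping: `‖m₀‖ ≤ ‖m_J‖ + Σ_{j<J} ‖mⱼ − mⱼ₊₁‖`. [folklore] -/
theorem norm_le_norm_add_sum_norm_sub (m : ℕ → F) (J : ℕ) :
    ‖m 0‖ ≤ ‖m J‖ + ∑ j ∈ Finset.range J, ‖m j - m (j + 1)‖ := by
  induction J with
  | zero => simp
  | succ J ih =>
    rw [Finset.sum_range_succ]
    have h : ‖m J‖ ≤ ‖m (J + 1)‖ + ‖m J - m (J + 1)‖ := norm_le_norm_add_norm_sub' _ _
    linarith

/-! ### The chain lemma -/

section Chain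

variable {f : EuclideanSpace ℝ (Fin 3) → F} {η : EuclideanSpace ℝ (Fin 3) → ℝ} {k d : ℝ}
  {y v : EuclideanSpace ℝ (Fin 3)}

/-- Mass of a nonnegative integrable density on a set where the weight is bounded below:
if `θ > 0`, `θ ≤ η` on `A` and `g ≥ 0` then `∫_A g ≤ θ⁻¹ ∫ g η`. [folklore] -/
theorem setIntegral_le_inv_mul_integral_mul_of_le {g : EuclideanSpace ℝ (Fin 3) → ℝ}
    (hg0 : ∀ x, 0 ≤ g x) (hη0 : ∀ x, 0 ≤ η x) {A : Set (EuclideanSpace ℝ (Fin 3))}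
    (hA : MeasurableSet A) {θ : ℝ} (hθ : 0 < θ) (hθA : ∀ x ∈ A, θ ≤ η x)
    (hgA : IntegrableOn g A volume) (hgη : Integrable fun x => g x * η x) :
    ∫ x in A, g x ≤ θ⁻¹ * ∫ x, g x * η x := by
  calc ∫ x in A, g x ≤ ∫ x in A, θ⁻¹ * (g x * η x) := by
        refine setIntegral_mono_on hgA ((hgη.const_mul θ⁻¹).integrableOn) hA fun x hx => ?_
        have h1 : g x * θ ≤ g x * η x := mul_le_mul_of_nonneg_left (hθA x hx) (hg0 x)
        calc g x = θ⁻¹ * (g x * θ) := by field_simp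
          _ ≤ θ⁻¹ * (g x * η x) := mul_le_mul_of_nonneg_left h1 (inv_nonneg.2 hθ.le)
    _ = θ⁻¹ * ∫ x in A, g x * η x := integral_const_mul _ _
    _ ≤ θ⁻¹ * ∫ x, g x * η x := by
        refine mul_le_mul_of_nonneg_left ?_ (inv_nonneg.2 hθ.le)
        exact setIntegral_le_integral hgη (Eventually.of_forall fun x => mul_nonneg (hg0 x) (hη0 x))

/-- **The Whitney-scale mass bound along a chain** (abstract form of Tao's parent-ball chaining,
pp. 32–33): let `f ∈ C¹(ℝ³; F)`, `η ≥ 0`, `0 < d ≤ k⁻¹`, `|v| = 1`, and suppose that for every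
`τ ∈ [d, k⁻¹]` the weight satisfies `η ≥ (3/4) k τ` on the ball `B(y + (τ − d) v, τ/4)`. If
`‖f‖²η` and `‖Df‖²η` are integrable, then
`∫_{B(y, d/4)} ‖f‖² ≤ 2·10⁶ · (d/4) · (k ∫‖f‖²η + k⁻¹ ∫‖Df‖²η)`. [cite: Tao2011, §10, proof of Thm. 10.1 (pp. 32–33, (10.22)–(10.24))] -/
theorem setIntegral_ball_sq_norm_le_of_chain (hf : ContDiff ℝ 1 f) (hη0 : ∀ x, 0 ≤ η x)
    (hk : 0 < k) (hd : 0 < d) (hdk : d ≤ k⁻¹) (hv : ‖v‖ = 1)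
    (hchain : ∀ τ ∈ Icc d k⁻¹, ∀ z ∈ ball (y + (τ - d) • v) (τ / 4), 3 / 4 * (k * τ) ≤ η z)
    (hW : Integrable fun x => ‖f x‖ ^ 2 * η x)
    (hY : Integrable fun x => ‖fderiv ℝ f x‖ ^ 2 * η x) :
    ∫ x in ball y (d / 4), ‖f x‖ ^ 2 ≤
      2000000 * (d / 4) * (k * (∫ x, ‖f x‖ ^ 2 * η x) + k⁻¹ * ∫ x, ‖fderiv ℝ f x‖ ^ 2 * η x) := by
  classical
  -- notation
  set W : ℝ := ∫ x, ‖f x‖ ^ 2 * η x with hWdef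
  set Y : ℝ := ∫ x, ‖fderiv ℝ f x‖ ^ 2 * η x with hYdef
  set vol : ℝ := (volume : Measure (EuclideanSpace ℝ (Fin 3))).real (ball 0 1) with hvol
  have hvol0 : 0 < vol := volumeReal_unitBall_pos
  have hW0 : 0 ≤ W := integral_nonneg fun x => mul_nonneg (sq_nonneg _) (hη0 x)
  have hY0 : 0 ≤ Y := integral_nonneg fun x => mul_nonneg (sq_nonneg _) (hη0 x)
  have hfc : Continuous f := hf.continuous
  have hDfc : Continuous (fderiv ℝ f) := hf.continuous_fderiv one_ne_zero
  have hkinv : 0 < k⁻¹ := inv_pos.2 hk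
  have hdk1 : d * k ≤ 1 := by rwa [← le_div_iff₀ hk, one_div]
  -- the chain of scales and centres
  set t : ℕ → ℝ := fun j => d * (3 / 2) ^ j with ht
  set c : ℕ → EuclideanSpace ℝ (Fin 3) := fun j => y + (t j - d) • v with hc
  have ht_pos : ∀ j, 0 < t j := fun j => by positivity
  have ht0 : t 0 = d := by simp [ht]
  have ht_succ : ∀ j, t (j + 1) = 3 / 2 * t j := fun j => by simp only [ht, pow_succ]; ring
  have ht_mono : ∀ {i j}, i ≤ j → t i ≤ t j := fun {i j} hij =>
    mul_le_mul_of_nonneg_left (pow_le_pow_right₀ (by norm_num) hij) hd.le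
  have hd_le_t : ∀ j, d ≤ t j := fun j => by rw [← ht0]; exact ht_mono (Nat.zero_le j)
  have hc0 : c 0 = y := by simp [hc, ht0]
  have hc_succ : ∀ j, c (j + 1) = c j + (t j / 2) • v := fun j => by
    simp only [hc, ht_succ]
    rw [add_assoc, ← add_smul]
    congr 2
    ring
  have ht_succ4 : ∀ j, t (j + 1) / 4 = 3 * t j / 8 := fun j => by rw [ht_succ]; ring
  have ht_inv : ∀ j, (t j)⁻¹ = d⁻¹ * ((2 : ℝ) / 3) ^ j := fun j => by
    simp only [ht, mul_inv, ← inv_pow]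
    norm_num
  -- the terminal index `J`
  have hex : ∃ j : ℕ, k⁻¹ / 2 ≤ t j := by
    obtain ⟨n, hn⟩ := pow_unbounded_of_one_lt (k⁻¹ / (2 * d)) (by norm_num : (1 : ℝ) < 3 / 2)
    refine ⟨n, ?_⟩
    have : k⁻¹ / (2 * d) * d ≤ (3 / 2) ^ n * d := mul_le_mul_of_nonneg_right hn.le hd.le
    calc k⁻¹ / 2 = k⁻¹ / (2 * d) * d := by field_simp
      _ ≤ (3 / 2) ^ n * d := this
      _ = t n := by simp only [ht]; ring
  set J : ℕ := Nat.find hex with hJdef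
  have hJ : k⁻¹ / 2 ≤ t J := Nat.find_spec hex
  have hJmin : ∀ j < J, t j < k⁻¹ / 2 := fun j hj => not_le.1 (Nat.find_min hex hj)
  have htJ : t J ≤ k⁻¹ := by
    rcases Nat.eq_zero_or_pos J with hJ0 | hJpos
    · rw [hJ0, ht0]; exact hdk
    · obtain ⟨J', hJ'⟩ := Nat.exists_eq_add_of_lt hJpos
      rw [zero_add] at hJ'
      have h1 := hJmin J' (by omega)
      rw [hJ', ht_succ]
      linarith
  have ht_Icc : ∀ j ≤ J, t j ∈ Icc d k⁻¹ := fun j hj => ⟨hd_le_t j, (ht_mono hj).trans htJ⟩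
  -- the weight on the balls of the chain
  have hηB : ∀ j ≤ J, ∀ z ∈ ball (c j) (t j / 4), 3 / 4 * (k * t j) ≤ η z := fun j hj z hz =>
    hchain (t j) (ht_Icc j hj) z hz
  -- means
  set m : ℕ → F := fun j => ⨍ x in ball (c j) (t j / 4), f x with hm
  -- Step bound: `‖mⱼ − mⱼ₊₁‖ ≤ K₁ / tⱼ` for `j < J`
  set K₁ : ℝ := Real.sqrt (840192 * Y / (vol * k)) with hK₁
  have hK₁0 : 0 ≤ K₁ := Real.sqrt_nonneg _
  have hK₁sq : K₁ ^ 2 = 840192 * Y / (vol * k) := Real.sq_sqrt (by positivity)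
  have hstep : ∀ j < J, ‖m j - m (j + 1)‖ ≤ K₁ / t j := by
    intro j hj
    have hj1 : j + 1 ≤ J := hj
    -- gradient mass on the union
    set A : Set (EuclideanSpace ℝ (Fin 3)) := ball (c j) (t j / 4) ∪ ball (c (j + 1)) (t (j + 1) / 4)
      with hA
    have hGA : ∫ x in A, ‖fderiv ℝ f x‖ ^ 2 ≤ (3 / 4 * (k * t j))⁻¹ * Y := by
      refine setIntegral_le_inv_mul_integral_mul_of_le (fun x => sq_nonneg _) hη0
        (measurableSet_ball.union measurableSet_ball) (by positivity) ?_
        (integrableOn_of_continuous_of_isBounded (hDfc.norm.pow 2)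
          (isBounded_ball.union isBounded_ball)) hY
      intro x hx
      rcases hx with hx | hx
      · exact hηB j hj.le x hx
      · have h1 := hηB (j + 1) hj1 x hx
        have h2 : t j ≤ t (j + 1) := ht_mono (Nat.le_succ j)
        nlinarith
    have hS := sq_norm_setAverage_ball_sub_parent_le hf (ht_pos j) hv (c := c j)
    rw [← hc_succ, ← ht_succ4] at hS
    have hsq : ‖m j - m (j + 1)‖ ^ 2 ≤ (K₁ / t j) ^ 2 := by
      calc ‖m j - m (j + 1)‖ ^ 2 ≤ 630144 / (vol * t j) * ∫ x in A, ‖fderiv ℝ f x‖ ^ 2 := hS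
        _ ≤ 630144 / (vol * t j) * ((3 / 4 * (k * t j))⁻¹ * Y) :=
            mul_le_mul_of_nonneg_left hGA (by positivity)
        _ = (K₁ / t j) ^ 2 := by
            rw [div_pow, hK₁sq]
            field_simp
            ring
    exact (pow_le_pow_iff_left₀ (norm_nonneg _) (by positivity) two_ne_zero).1 hsq
  -- sum of the steps
  have hsum : ∑ j ∈ Finset.range J, ‖m j - m (j + 1)‖ ≤ 3 * K₁ / d := by
    calc ∑ j ∈ Finset.range J, ‖m j - m (j + 1)‖ ≤ ∑ j ∈ Finset.range J, K₁ / t j :=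
          Finset.sum_le_sum fun j hj => hstep j (Finset.mem_range.1 hj)
      _ = K₁ / d * ∑ j ∈ Finset.range J, ((2 : ℝ) / 3) ^ j := by
          rw [Finset.mul_sum]
          refine Finset.sum_congr rfl fun j _ => ?_
          rw [div_eq_mul_inv, ht_inv]; ring
      _ ≤ K₁ / d * 3 := mul_le_mul_of_nonneg_left (sum_range_two_thirds_pow_le J) (by positivity)
      _ = 3 * K₁ / d := by ring
  have hm0 : ‖m 0‖ ≤ ‖m J‖ + 3 * K₁ / d :=
    (norm_le_norm_add_sum_norm_sub m J).trans (by linarith)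
  -- the terminal mean
  have hmJ : ‖m J‖ ^ 2 ≤ 4096 / 3 * k ^ 3 * W / vol := by
    have hmass : ∫ x in ball (c J) (t J / 4), ‖f x‖ ^ 2 ≤ (3 / 4 * (k * t J))⁻¹ * W :=
      setIntegral_le_inv_mul_integral_mul_of_le (fun x => sq_nonneg _) hη0 measurableSet_ball
        (by positivity) (hηB J le_rfl)
        (integrableOn_of_continuous_of_isBounded (hfc.norm.pow 2) isBounded_ball) hW
    have hJensen := volumeReal_mul_sq_norm_setAverage_ball_le hfc (c J) (by positivity : 0 < t J / 4)
    rw [volumeReal_ball_eq _ (by positivity : 0 ≤ t J / 4)] at hJensen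
    have hV : (k⁻¹ / 8) ^ 3 * vol ≤ (t J / 4) ^ 3 * vol := by
      apply mul_le_mul_of_nonneg_right _ hvol0.le
      apply pow_le_pow_left₀ (by positivity)
      linarith
    have h34 : (3 / 4 * (k * t J))⁻¹ ≤ 8 / 3 := by
      rw [inv_le_comm₀ (by positivity) (by norm_num)]
      have : k * (k⁻¹ / 2) ≤ k * t J := mul_le_mul_of_nonneg_left hJ hk.le
      rw [mul_div_assoc', mul_inv_cancel₀ hk.ne'] at this
      linarith
    have h1 : (k⁻¹ / 8) ^ 3 * vol * ‖m J‖ ^ 2 ≤ 8 / 3 * W := by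
      calc (k⁻¹ / 8) ^ 3 * vol * ‖m J‖ ^ 2 ≤ (t J / 4) ^ 3 * vol * ‖m J‖ ^ 2 :=
            mul_le_mul_of_nonneg_right hV (sq_nonneg _)
        _ ≤ ∫ x in ball (c J) (t J / 4), ‖f x‖ ^ 2 := hJensen
        _ ≤ (3 / 4 * (k * t J))⁻¹ * W := hmass
        _ ≤ 8 / 3 * W := mul_le_mul_of_nonneg_right h34 hW0
    have h2 : (k⁻¹ / 8) ^ 3 * vol * ‖m J‖ ^ 2 = vol * ‖m J‖ ^ 2 / (512 * k ^ 3) := by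
      field_simp
      ring
    rw [h2, div_le_iff₀ (by positivity)] at h1
    rw [le_div_iff₀ hvol0]
    linarith
  -- Poincaré (mass form) on the initial ball
  have hP0 := setIntegral_ball_sq_norm_le hf y (by positivity : 0 < d / 4)
  have hG0 : ∫ x in ball y (d / 4), ‖fderiv ℝ f x‖ ^ 2 ≤ (3 / 4 * (k * d))⁻¹ * Y := by
    have h := setIntegral_le_inv_mul_integral_mul_of_le (fun x => sq_nonneg _) hη0 measurableSet_ball
      (by positivity : 0 < 3 / 4 * (k * d)) ?_
      (integrableOn_of_continuous_of_isBounded (hDfc.norm.pow 2) isBounded_ball) hY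
      (A := ball y (d / 4))
    · exact h
    · intro x hx
      have := hηB 0 (Nat.zero_le _) x (by rwa [hc0, ht0])
      rwa [ht0] at this
  rw [volumeReal_ball_eq y (by positivity : 0 ≤ d / 4)] at hP0
  have hm0' : ‖m 0‖ = ‖⨍ x in ball y (d / 4), f x‖ := by rw [hm]; simp only [hc0, ht0]
  have hm0sq : ‖⨍ x in ball y (d / 4), f x‖ ^ 2 ≤ 2 * ‖m J‖ ^ 2 + 2 * (3 * K₁ / d) ^ 2 := by
    rw [← hm0']
    have h1 : 0 ≤ ‖m J‖ + 3 * K₁ / d := by positivity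
    nlinarith [norm_nonneg (m 0), sq_nonneg (‖m J‖ - 3 * K₁ / d)]
  -- assembly of the real inequalities
  have hdY : 0 ≤ d * Y := by positivity
  calc ∫ x in ball y (d / 4), ‖f x‖ ^ 2
      ≤ 64 * (d / 4) ^ 2 * (∫ x in ball y (d / 4), ‖fderiv ℝ f x‖ ^ 2) +
          2 * ((d / 4) ^ 3 * vol) * ‖⨍ x in ball y (d / 4), f x‖ ^ 2 := hP0
    _ ≤ 64 * (d / 4) ^ 2 * ((3 / 4 * (k * d))⁻¹ * Y) +
          2 * ((d / 4) ^ 3 * vol) * (2 * (4096 / 3 * k ^ 3 * W / vol) + 2 * (3 * K₁ / d) ^ 2) := by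
        gcongr
        exact hm0sq.trans (by linarith)
    _ = 16 / 3 * (d * Y / k) + 256 / 3 * (d * k) ^ 2 * (d * k * W) + 472608 * (d * Y / k) := by
        rw [show (3 * K₁ / d) ^ 2 = 9 * K₁ ^ 2 / d ^ 2 by ring, hK₁sq]
        field_simp
        ring
    _ ≤ 16 / 3 * (d * Y / k) + 256 / 3 * 1 * (d * k * W) + 472608 * (d * Y / k) := by
        have hdkW : 0 ≤ d * k * W := mul_nonneg (mul_nonneg hd.le hk.le) hW0
        have hsq : (d * k) ^ 2 ≤ 1 := by
          rw [sq]; exact mul_le_one₀ hdk1 (mul_nonneg hd.le hk.le) hdk1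
        have := mul_le_mul_of_nonneg_right hsq hdkW
        linarith
    _ ≤ 2000000 * (d / 4) * (k * W + k⁻¹ * Y) := by
        have hA : 0 ≤ d * Y / k := div_nonneg hdY hk.le
        have hB : 0 ≤ d * k * W := mul_nonneg (mul_nonneg hd.le hk.le) hW0
        have e : 2000000 * (d / 4) * (k * W + k⁻¹ * Y) =
            500000 * (d * k * W) + 500000 * (d * Y / k) := by
          rw [div_eq_mul_inv (d * Y) k]; ring
        rw [e]
        linarith

end Chain

end Literature.Analysis.FluidPDE.TaoY6

end
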